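import Mathlib
import HarnessLib
import Literature.MathematicalPhysics.QuantumLattice.KohnLuttinger
import Literature.MathematicalPhysics.QuantumLattice.KohnLuttingerFermiCurvePolarIntegral
import Summits.HubbardSuperconductivity.HubbardSuperconductivity.Theorems.WeakCouplingBCSWcbcsKohnLuttingerB1gReduction
import Summits.HubbardSuperconductivity.HubbardSuperconductivity.Theorems.WeakCouplingBCSWcbcsKohnLuttingerB1gMuWindow

/-!
# Route `WeakCouplingBCS` — support item `WcbcsKohnLuttingerB1g` (stmt-HubbardSuperconductivity-0158):
# the item from a certificate on a chemical-potential window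

`wcbcsKohnLuttingerB1g_of_mu_certificate`: combining the reduction
(`wcbcsKohnLuttingerB1g_of_certificate`), the finiteness of the density-of-states measure
(`Literature…KohnLuttingerFermiCurvePolarIntegral.isFiniteMeasure_fermiCurveMeasure`, polar picture) and
the doping/chemical-potential window
(`chemicalPotentialOfDensity_window`), the route item `WcbcsKohnLuttingerB1g` holds verbatim as soon
as, on some window `-4 < μ₂ < μ₁ < 0` and uniformly in `μ ∈ [μ₂, μ₁]`:
(ii) the Lindhard function is bounded on `F_μ + F_μ`; (iii) per-channel lower bounds `Λ μ χ ≤ Q(ψ)`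
for the normalised channel states; (iv) a normalised mean-zero `B1g` state with `Q ≤ ΛB μ`;
(v) `ΛB μ + γ ≤ Λ μ χ ≤ 0` for `χ ≠ B1g`. These are exactly the deliverables of the
interval-arithmetic certificate attached to the item as compute evidence.

References: S. Raghu, S. A. Kivelson, D. J. Scalapino, Phys. Rev. B 81 (2010) 224505, §III Fig. 2.
-/

noncomputable section

-- the tree's namespace `Summit.<Summit>.<Problem>.Theorems` repeats the summit name by design (D-0017)
set_option linter.dupNamespace false

namespace Summit.HubbardSuperconductivity.HubbardSuperconductivity.Theorems

open MeasureTheory Literature.MathematicalPhysics.QuantumLattice Real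

/-- **`WcbcsKohnLuttingerB1g` from a certificate on a chemical-potential window.** Let
`-4 < μ₂ < μ₁ < 0` and `γ > 0`. Suppose that for every `μ ∈ [μ₂, μ₁]`, with `σ = fermiCurveMeasure ε μ`,
`χ₀ = lindhardFunction ε μ`, `Q(ψ) = ∫∫ ψ(k) χ₀(k+k') ψ(k') dσ dσ`:
(ii) `|χ₀(k+k')| ≤ C μ` on `F_μ + F_μ`; (iii) `Λ μ χ ≤ Q(ψ)` for every normalised state of every channel;
(iv) a normalised mean-zero `B1g` state has `Q ≤ ΛB μ`; (v) `ΛB μ + γ ≤ Λ μ χ ≤ 0` for `χ ≠ B1g`.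
Then the route item holds, with the doping window `[1 - n(μ₁), 1 - n(μ₂)]` and any `U₁ > 0`
(finiteness of `σ` is the polar-coordinates lemma `isFiniteMeasure_fermiCurveMeasure` of
`KohnLuttingerFermiCurvePolarIntegral.lean`; the window is `chemicalPotentialOfDensity_window`). [cite: RaghuKivelsonScalapino2010, §III Fig. 2] -/
theorem wcbcsKohnLuttingerB1g_of_mu_certificate {μ₁ μ₂ γ : ℝ} {C ΛB : ℝ → ℝ} {Λ : ℝ → D4Irrep → ℝ}
    (h4 : -4 < μ₂) (h12 : μ₂ < μ₁) (h0 : μ₁ < 0) (hγ : 0 < γ)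
    (hbdd : ∀ μ ∈ Set.Icc μ₂ μ₁,
      ∀ k ∈ fermiCurve (squareDispersion 1 0) μ, ∀ k' ∈ fermiCurve (squareDispersion 1 0) μ,
        |lindhardFunction (squareDispersion 1 0) μ (k + k')| ≤ C μ)
    (hlow : ∀ μ ∈ Set.Icc μ₂ μ₁, ∀ χ : D4Irrep, ∀ ψ, IsChannelState (squareDispersion 1 0) μ χ ψ →
      Λ μ χ ≤ ∫ k, ψ k * ∫ k', lindhardFunction (squareDispersion 1 0) μ (k + k') * ψ k'
        ∂fermiCurveMeasure (squareDispersion 1 0) μ ∂fermiCurveMeasure (squareDispersion 1 0) μ)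
    (hwit : ∀ μ ∈ Set.Icc μ₂ μ₁, ∃ ψ, IsChannelState (squareDispersion 1 0) μ D4Irrep.B1g ψ ∧
      ∫ k, ψ k ∂fermiCurveMeasure (squareDispersion 1 0) μ = 0 ∧
      ∫ k, ψ k * ∫ k', lindhardFunction (squareDispersion 1 0) μ (k + k') * ψ k'
        ∂fermiCurveMeasure (squareDispersion 1 0) μ ∂fermiCurveMeasure (squareDispersion 1 0) μ ≤ ΛB μ)
    (hgap : ∀ μ ∈ Set.Icc μ₂ μ₁, ∀ χ : D4Irrep, χ ≠ D4Irrep.B1g → ΛB μ + γ ≤ Λ μ χ)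
    (hΛ : ∀ μ ∈ Set.Icc μ₂ μ₁, ∀ χ : D4Irrep, χ ≠ D4Irrep.B1g → Λ μ χ ≤ 0) :
    ∃ a b γ U₁ : ℝ, 0 < a ∧ a < b ∧ b < 1 ∧ 0 < γ ∧ 0 < U₁ ∧ ∀ δ ∈ Set.Icc a b,
      ∀ U ∈ Set.Ioo (0:ℝ) U₁, ∀ χ : Literature.MathematicalPhysics.QuantumLattice.D4Irrep,
        χ ≠ Literature.MathematicalPhysics.QuantumLattice.D4Irrep.B1g →
          Literature.MathematicalPhysics.QuantumLattice.channelInf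
              (Literature.MathematicalPhysics.QuantumLattice.squareDispersion 1 0)
              (Literature.MathematicalPhysics.QuantumLattice.chemicalPotentialOfDensity
                (Literature.MathematicalPhysics.QuantumLattice.squareDispersion 1 0) (1 - δ)) U
              Literature.MathematicalPhysics.QuantumLattice.D4Irrep.B1g + γ * U ^ 2 ≤
            Literature.MathematicalPhysics.QuantumLattice.channelInf
              (Literature.MathematicalPhysics.QuantumLattice.squareDispersion 1 0)
              (Literature.MathematicalPhysics.QuantumLattice.chemicalPotentialOfDensity
                (Literature.MathematicalPhysics.QuantumLattice.squareDispersion 1 0) (1 - δ)) U χ := by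
  obtain ⟨ha, hab, hb, hwin⟩ := chemicalPotentialOfDensity_window h4 h12 h0
  set a := 1 - KohnLuttinger.filling (squareDispersion 1 0) μ₁
  set b := 1 - KohnLuttinger.filling (squareDispersion 1 0) μ₂
  set μof : ℝ → ℝ := fun δ => chemicalPotentialOfDensity (squareDispersion 1 0) (1 - δ) with hμof
  have hmem : ∀ δ ∈ Set.Icc a b, μof δ ∈ Set.Icc μ₂ μ₁ := hwin
  have hIoo : ∀ δ ∈ Set.Icc a b, μof δ ∈ Set.Ioo (-4 : ℝ) 0 := fun δ hδ =>
    ⟨lt_of_lt_of_le h4 (hmem δ hδ).1, lt_of_le_of_lt (hmem δ hδ).2 h0⟩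
  exact wcbcsKohnLuttingerB1g_of_certificate (C := fun δ => C (μof δ)) (ΛB := fun δ => ΛB (μof δ))
    (Λ := fun δ => Λ (μof δ)) ha hab hb hγ one_pos
    (fun δ hδ => Literature.MathematicalPhysics.QuantumLattice.isFiniteMeasure_fermiCurveMeasure
      (hIoo δ hδ).1 (hIoo δ hδ).2)
    (fun δ hδ => hbdd _ (hmem δ hδ)) (fun δ hδ => hlow _ (hmem δ hδ)) (fun δ hδ => hwit _ (hmem δ hδ))
    (fun δ hδ => hgap _ (hmem δ hδ)) (fun δ hδ => hΛ _ (hmem δ hδ))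

end Summit.HubbardSuperconductivity.HubbardSuperconductivity.Theorems

end
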